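import Literature.NumberTheory.Rogawski1990.UnitFundamentalLemmaInertResiduallyRegularExplicit   -- ★ A-p06 (g26) JUNCTION-rr: `endoEmbLocal_mem_cmLocalIntegralLevel_of_nonsplit` (+ (D1), ★ p839937, `redMat`, `glInt`)
import Literature.NumberTheory.Automorphic.GLnResiduallyRegularConjugacy                        -- ★ `GLn.charpoly_redMat_map_eq`
import Literature.NumberTheory.Automorphic.LocalGLCongruenceBoxIwahori                           -- ★ `localGLPiEquiv_apply_apply`
import Literature.NumberTheory.Automorphic.ValuedFieldValuativeRelBridge                         -- ★ `v_eq_one_iff_valuation_eq_one`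
import HarnessLib

/-!
# Residual regularity of `ι_v(γ_H)` at a non-split place forces `χ_g(u)_w ∈ 𝒪_wˣ` (`n₁₂ = n₂₃ = 0`) and residual regularity of `g` (Rogawski (1990) §4.9; Kottwitz (1986) §7)

Topic `NumberTheory/Rogawski1990`; namespace `Literature.NumberTheory.Rogawski1990`.  THEOREMS ONLY (no definition, no named fact, no instance, no notation,
no `sorry`; net debt 0).  Cell `pub/hodgecm-mathlib`, F0∕P3a, topic T8 — the «`hsepι ⇒ (hc ∧ hsep₂)`» BRIDGE discharging the two stratum binders `hsep₂`, `hc` of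
★ A-p06 (g26) `stableOrbitalIntegralRel_indicator_eq_finsum_finExplicitDelta_of_separable_redMat_of_nonsplit` (`UnitFundamentalLemmaInertResiduallyRegularExplicit`,
LEAD F0P3a-plan (g9) T8-19 (D)(4); binder shapes fixed by A-p06 2026-09-01 02:16Z).  Drafted by B-p10 (g23); completed by A-p06 (g26) (LEAD T8-22 (B)(4) ∕
T8-25): the reduction step is done FORMALLY — `redMat` is entrywise, so the block pattern of `ι_v(γ_H)_w` survives reduction with no
integrality hypothesis and no integral `GL₃`-model (whose elaboration over the concrete `L_w` exceeded the default heartbeats).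
Mathlib-only footing; count-neutral for the books.

THE MATHEMATICS.  For `γ_H = (g, u) ∈ K_H = U(Φ₂)(𝒪_v) × U(Φ₁)(𝒪_v)` at a non-split place `v` (`c • w = w`), `ι_v(γ_H) ∈ U(Φ₃)(𝒪_v)` (★
`endoEmbLocal_mem_cmLocalIntegralLevel_of_nonsplit`); its `w`-component is the block pattern `ι(g_w, u_w) = (a 0 b; 0 u 0; c 0 d)` (★ `map_endoGL`,
★ `coe_endoGL`), and the entrywise reduction `redMat` (★ `IntegralMatrixReduction`) preserves that pattern, whence — formally, for every `γ_H` —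
`charpoly (ι_v(γ_H)_w mod 𝔪_w) = charpoly (g_w mod 𝔪_w) · (X − ū_w)` (Mathlib `Matrix.charpoly_reindex`, `Matrix.charpoly_fromBlocks_zero₁₂`).  If the left side is SEPARABLE (the
residual-regularity idiom `hsepι` of the junction), then `charpoly (g_w mod 𝔪_w)` is separable (`hsep₂`; Mathlib `Polynomial.Separable.of_mul_left`) and coprime to
`X − ū_w` (`Polynomial.Separable.isCoprime`), i.e. `χ̄_g(ū) ≠ 0`: the `w`-component of `χ_g(u) = (u − γ₁)(u − γ₃)` (★ `(finCharpolyTwo …).eval (finGammaTwo …)`) is a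
`w`-adic UNIT, `v_w(χ_g(u)) = 1` (`hc`) — print's residually regular stratum `n₁₂ = n₂₃ = 0` (`n_{ij} = ord_w(γ_i − γ_j)`), on which `Δ_{G∕H}(γ) = 1`.

* §0 generic: `eval_ne_zero_of_isCoprime_X_sub_C`.
* §1 `redMat_map_endoEmbLocal_eq_reindex_fromBlocks`, `charpoly_redMat_endoEmbLocal_apply` (`charpoly (ι_v(γ_H)_w mod 𝔪_w) = χ̄_{g_w} · (X − ū_w)`,
  EVERY `γ_H`), `charpoly_map_endoEmbLocal_apply` (the same over `L_w`), **`separable_charpoly_redMat_fst_of_separable_redMat_endoEmbLocal`** (`hsep₂`,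
  every `γ_H`), **`valued_eval_finCharpolyTwo_finGammaTwo_eq_one_of_separable_redMat_endoEmbLocal`** (`hc`, on `K_H`).
HONEST LABEL: HC_CM is proved only modulo the printed citations (named inputs remaining 2) until rung 0 closes; this file proves none of them.

## References
* [Rogawski1990] J. D. Rogawski, *Automorphic Representations of Unitary Groups in Three Variables*, Ann. of Math. Stud. 123 (1990), §4.9 p. 55 (`γ₁, γ₂, γ₃`,
  `χ_g`, `Δ_{G∕H} = 1` on `K` for unit discriminant), §4.3 p. 42 (`ι : H → G`), §3.3 p. 21.
* [Kottwitz1986] R. Kottwitz, *Base change for unit elements of Hecke algebras*, Compositio Math. 60 (1986), §7 (residually regular ∕ separable reduction), Prop. 7.1.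
-/

set_option autoImplicit false

noncomputable section

open NumberField IsDedekindDomain Matrix Polynomial ValuativeRel
open scoped MatrixGroups ValuativeRel

namespace Literature.NumberTheory.Rogawski1990

open Literature.NumberTheory.Automorphic Literature.NumberTheory.Automorphic.UnitaryGroup Literature.NumberTheory.Automorphic.IntegralReduction

/-! ## §0 Generic lemma -/

/-- `IsCoprime p (X − a)` over a non-trivial commutative ring forces `p(a) ≠ 0` (else `X − a ∣ p` and `X − a` would be a unit). [folklore] -/
private theorem eval_ne_zero_of_isCoprime_X_sub_C {R : Type*} [CommRing R] [Nontrivial R] {p : R[X]} {a : R} (h : IsCoprime p (X - C a)) :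
    p.eval a ≠ 0 := fun h0 =>
  Polynomial.not_isUnit_X_sub_C a (h.isUnit_of_dvd' (Polynomial.dvd_iff_isRoot.2 h0) dvd_rfl)

/-- `charpoly` of a `1 × 1` matrix. [folklore] -/
private theorem charpoly_fin_one' {R : Type*} [CommRing R] (A : Matrix (Fin 1) (Fin 1) R) : A.charpoly = X - C (A 0 0) := by
  rw [Matrix.charpoly, Matrix.det_fin_one, Matrix.charmatrix_apply_eq]

/-! ## §1 The reduced characteristic polynomial of `ι_v(γ_H)_w` and its two consequences -/

section Bridge

variable (L : Type) [Field L] [NumberField L] [IsCMField L] {v : HeightOneSpectrum (𝓞 ↥(maximalRealSubfield L))}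
  (w : PlacesOver L v) (hw : IsCMField.complexConj L • w.1 = w.1)
  {γH : (cmDatum L 2 (Matrix.of fun i j : Fin 2 => if i.val + j.val + 1 = 2 then (1 : L) else 0)).Local v ×
      (cmDatum L 1 (Matrix.of fun i j : Fin 1 => if i.val + j.val + 1 = 1 then (1 : L) else 0)).Local v}
  (hγH : γH ∈ ((cmLocalIntegralLevel L 2 (Matrix.of fun i j : Fin 2 => if i.val + j.val + 1 = 2 then (1 : L) else 0) v).prod
      (cmLocalIntegralLevel L 1 (Matrix.of fun i j : Fin 1 => if i.val + j.val + 1 = 1 then (1 : L) else 0) v)))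

/-- An integral `w`-component `g_w ∈ GL_N(𝒪_w)` of `g ∈ U(J)(𝒪_v)`: the model `G₀` with `G₀ ⊗ 1 = g_w` (★ `mem_localIntegralLevel_iff`, ★ `glInt`, ★
`localGLPiEquiv_apply_apply`). [cite: Kottwitz1986, §7] -/
private theorem exists_gl_integer_coe_eq_map (N : ℕ) (J : Matrix (Fin N) (Fin N) L) (g : (cmDatum L N J).Local v) (hg : g ∈ cmLocalIntegralLevel L N J v) :
    ∃ G₀ : GL (Fin N) 𝒪[w.1.adicCompletion L],
      ((Matrix.GeneralLinearGroup.map (𝒪[w.1.adicCompletion L]).subtype G₀ : GL (Fin N) (w.1.adicCompletion L)) : Matrix (Fin N) (Fin N) (w.1.adicCompletion L)) =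
        ((g.val : GL (Fin N) (LocalRing L v)).val).map (Pi.evalRingHom (fun w' : PlacesOver L v => w'.1.adicCompletion L) w) := by
  obtain ⟨G₀, hG₀⟩ := (mem_localIntegralLevel_iff (IsCMField.complexConj L) N J v g).1 hg w
  refine ⟨G₀, ?_⟩
  rw [hG₀]
  ext i j
  rw [localGLPiEquiv_apply_apply, Matrix.map_apply]
  rfl

/-- `u_w = (u)_w` read through the evaluation at `w` (definitional). [cite: Rogawski1990, §4.9 p. 55] -/
private theorem evalRingHom_snd_apply :
    (Pi.evalRingHom (fun w' : PlacesOver L v => w'.1.adicCompletion L) w) (((γH.2.val : GL (Fin 1) (LocalRing L v)).val) 0 0) = finGammaTwo L v γH w := rfl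

/-- **`charpoly (ι_v(γ_H)_w) = charpoly (g_w) · (X − u_w)`** over `L_w` (★ `charpoly_endoEmb` pushed along the evaluation at `w`). [cite: Rogawski1990, §4.2 p. 42; §4.9 p. 55] -/
theorem charpoly_map_endoEmbLocal_apply :
    (((((endoEmbLocal L v γH).val : GL (Fin 3) (LocalRing L v)).val).map (Pi.evalRingHom (fun w' : PlacesOver L v => w'.1.adicCompletion L) w))).charpoly =
      ((((γH.1.val : GL (Fin 2) (LocalRing L v)).val).map (Pi.evalRingHom (fun w' : PlacesOver L v => w'.1.adicCompletion L) w))).charpoly * (X - C (finGammaTwo L v γH w)) := by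
  have h : ((((endoEmbLocal L v γH).val : GL (Fin 3) (LocalRing L v)).val)).charpoly =
      (((γH.1.val : GL (Fin 2) (LocalRing L v)).val)).charpoly * (X - C ((((γH.2.val : GL (Fin 1) (LocalRing L v)).val)) 0 0)) :=
    charpoly_endoEmb (endoForm_localForm L v) γH
  rw [Matrix.charpoly_map, Matrix.charpoly_map, h, Polynomial.map_mul, Polynomial.map_sub, Polynomial.map_X, Polynomial.map_C, evalRingHom_snd_apply]

/-- **The reduction of `ι_v(γ_H)_w` keeps the block pattern**: `ι_v(g, u)_w mod 𝔪_w = ι(g_w mod 𝔪_w, u_w mod 𝔪_w)` as matrices — ★ `map_endoGL` ∕ ★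
`coe_endoGL` (`ι = reindex endoPerm (· ⊕ ·)`), and the entrywise `redMat` commutes with `reindex` and `fromBlocks` (★ `redMat_zero` for the off-pattern
blocks).  No integrality is needed. [cite: Rogawski1990, §4.2 p. 42; §4.8 Case (a) p. 53] -/
theorem redMat_map_endoEmbLocal_eq_reindex_fromBlocks :
    redMat ((((endoEmbLocal L v γH).val : GL (Fin 3) (LocalRing L v)).val).map (Pi.evalRingHom (fun w' : PlacesOver L v => w'.1.adicCompletion L) w)) =
      Matrix.reindex endoPerm endoPerm (Matrix.fromBlocks
        (redMat (((γH.1.val : GL (Fin 2) (LocalRing L v)).val).map (Pi.evalRingHom (fun w' : PlacesOver L v => w'.1.adicCompletion L) w))) 0 0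
        (redMat (((γH.2.val : GL (Fin 1) (LocalRing L v)).val).map (Pi.evalRingHom (fun w' : PlacesOver L v => w'.1.adicCompletion L) w)))) := by
  have hmat : (((endoEmbLocal L v γH).val : GL (Fin 3) (LocalRing L v)).val).map (Pi.evalRingHom (fun w' : PlacesOver L v => w'.1.adicCompletion L) w) =
      ((endoGL (Matrix.GeneralLinearGroup.map (Pi.evalRingHom (fun w' : PlacesOver L v => w'.1.adicCompletion L) w) (γH.1.val : GL (Fin 2) (LocalRing L v)),
          Matrix.GeneralLinearGroup.map (Pi.evalRingHom (fun w' : PlacesOver L v => w'.1.adicCompletion L) w) (γH.2.val : GL (Fin 1) (LocalRing L v))) :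
          GL (Fin 3) (w.1.adicCompletion L)) : Matrix (Fin 3) (Fin 3) (w.1.adicCompletion L)) :=
    congrArg Units.val (map_endoGL (Pi.evalRingHom (fun w' : PlacesOver L v => w'.1.adicCompletion L) w)
      ((γH.1.val : GL (Fin 2) (LocalRing L v)), (γH.2.val : GL (Fin 1) (LocalRing L v))))
  have hz : ∀ (m m' : Type) , ((0 : Matrix m m' (w.1.adicCompletion L)).map red) = 0 := fun _ _ => redMat_zero
  rw [hmat, coe_endoGL, Matrix.reindex_apply, Matrix.reindex_apply, redMat, ← Matrix.submatrix_map, Matrix.fromBlocks_map, hz, hz]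
  rfl

/-- **`charpoly (ι_v(γ_H)_w mod 𝔪_w) = charpoly (g_w mod 𝔪_w) · (X − (u_w mod 𝔪_w))`** — for EVERY `γ_H` (formal consequence of the block pattern:
Mathlib `Matrix.charpoly_reindex`, `Matrix.charpoly_fromBlocks_zero₁₂`). [cite: Rogawski1990, §4.2 p. 42; §4.9 p. 55] [cite: Kottwitz1986, §7] -/
theorem charpoly_redMat_endoEmbLocal_apply :
    (redMat ((((endoEmbLocal L v γH).val : GL (Fin 3) (LocalRing L v)).val).map (Pi.evalRingHom (fun w' : PlacesOver L v => w'.1.adicCompletion L) w))).charpoly =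
      (redMat (((γH.1.val : GL (Fin 2) (LocalRing L v)).val).map (Pi.evalRingHom (fun w' : PlacesOver L v => w'.1.adicCompletion L) w))).charpoly * (X - C (red (finGammaTwo L v γH w))) := by
  rw [redMat_map_endoEmbLocal_eq_reindex_fromBlocks, Matrix.charpoly_reindex, Matrix.charpoly_fromBlocks_zero₁₂]
  exact congrArg _ (charpoly_fin_one' _)

/-- **`hsep₂` from `hsepι`: if `ι_v(γ_H)_w` has separable reduced characteristic polynomial then so does `g_w`** (`χ̄_g` divides `χ̄_g · (X − ū)`;
`Polynomial.Separable.of_mul_left`) — for EVERY `γ_H`. [cite: Kottwitz1986, §7] [cite: Rogawski1990, §4.9 p. 55] -/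
theorem separable_charpoly_redMat_fst_of_separable_redMat_endoEmbLocal
    (hsepι : (redMat ((((endoEmbLocal L v γH).val : GL (Fin 3) (LocalRing L v)).val).map
      (Pi.evalRingHom (fun w' : PlacesOver L v => w'.1.adicCompletion L) w))).charpoly.Separable) :
    (redMat (((γH.1.val : GL (Fin 2) (LocalRing L v)).val).map
      (Pi.evalRingHom (fun w' : PlacesOver L v => w'.1.adicCompletion L) w))).charpoly.Separable := by
  rw [charpoly_redMat_endoEmbLocal_apply L w] at hsepι
  exact hsepι.of_mul_left

include hγH in
/-- **`hc` from `hsepι`: ON `K_H`, RESIDUAL REGULARITY OF `ι_v(γ_H)` AT A NON-SPLIT `w` FORCES `χ_g(u)_w ∈ 𝒪_wˣ`** — `χ̄_g` and `X − ū` are coprime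
(`Polynomial.Separable.isCoprime`), so `χ̄_g(ū) ≠ 0`, and `χ_g(u)_w` is `w`-integral (`g`, `u` are) with that residue: `v_w(χ_g(u)) = 1`.  Print: the residually
regular stratum `n₁₂ = n₂₃ = 0` on which `Δ_{G∕H}(γ) = 1` (the binder `hc` of ★ `finExplicitDelta_eq_one_of_nonsplit_of_isUnramifiedIn_of_disc_isUnit`).
[cite: Rogawski1990, §4.9 p. 55] [cite: Kottwitz1986, §7, Prop. 7.1] -/
theorem valued_eval_finCharpolyTwo_finGammaTwo_eq_one_of_separable_redMat_endoEmbLocal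
    (hsepι : (redMat ((((endoEmbLocal L v γH).val : GL (Fin 3) (LocalRing L v)).val).map
      (Pi.evalRingHom (fun w' : PlacesOver L v => w'.1.adicCompletion L) w))).charpoly.Separable) :
    Valued.v (((finCharpolyTwo L v γH).eval (finGammaTwo L v γH)) w) = 1 := by
  obtain ⟨hK2, hK1⟩ := Subgroup.mem_prod.1 hγH
  rw [charpoly_redMat_endoEmbLocal_apply L w] at hsepι
  have hne := eval_ne_zero_of_isCoprime_X_sub_C hsepι.isCoprime
  -- integral models of `g_w`, `u_w`
  obtain ⟨G₀, hG₀⟩ := exists_gl_integer_coe_eq_map L w 2 (Matrix.of fun i j : Fin 2 => if i.val + j.val + 1 = 2 then (1 : L) else 0) γH.1 hK2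
  obtain ⟨U₀, hU₀⟩ := exists_gl_integer_coe_eq_map L w 1 (Matrix.of fun i j : Fin 1 => if i.val + j.val + 1 = 1 then (1 : L) else 0) γH.2 hK1
  have hu₀ : ((𝒪[w.1.adicCompletion L]).subtype ((U₀ : Matrix (Fin 1) (Fin 1) 𝒪[w.1.adicCompletion L]) 0 0)) = finGammaTwo L v γH w := by
    exact congrArg (fun X : Matrix (Fin 1) (Fin 1) (w.1.adicCompletion L) => X 0 0) hU₀
  -- `χ_g(u)_w = (charpoly G₀)(u₀) ⊗ 1`
  have hχ : ((finCharpolyTwo L v γH).eval (finGammaTwo L v γH)) w =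
      (𝒪[w.1.adicCompletion L]).subtype ((G₀ : Matrix (Fin 2) (Fin 2) 𝒪[w.1.adicCompletion L]).charpoly.eval
        ((U₀ : Matrix (Fin 1) (Fin 1) 𝒪[w.1.adicCompletion L]) 0 0)) := by
    have e1 : ((finCharpolyTwo L v γH).eval (finGammaTwo L v γH)) w =
        ((finCharpolyTwo L v γH).map (Pi.evalRingHom (fun w' : PlacesOver L v => w'.1.adicCompletion L) w)).eval
          ((Pi.evalRingHom (fun w' : PlacesOver L v => w'.1.adicCompletion L) w) (finGammaTwo L v γH)) := by
      show (Pi.evalRingHom (fun w' : PlacesOver L v => w'.1.adicCompletion L) w) ((finCharpolyTwo L v γH).eval (finGammaTwo L v γH)) = _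
      rw [Polynomial.eval_map, Polynomial.eval₂_at_apply]
    have e2 : (finCharpolyTwo L v γH).map (Pi.evalRingHom (fun w' : PlacesOver L v => w'.1.adicCompletion L) w) =
        (G₀ : Matrix (Fin 2) (Fin 2) 𝒪[w.1.adicCompletion L]).charpoly.map (𝒪[w.1.adicCompletion L]).subtype := by
      unfold finCharpolyTwo
      rw [← Matrix.charpoly_map, ← hG₀, ← Matrix.charpoly_map, ← RingHom.mapMatrix_apply]
      rfl
    rw [e1, e2, show (Pi.evalRingHom (fun w' : PlacesOver L v => w'.1.adicCompletion L) w) (finGammaTwo L v γH) = finGammaTwo L v γH w from rfl, ← hu₀,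
      Polynomial.eval_map, Polynomial.eval₂_at_apply]
  have hχO : ((finCharpolyTwo L v γH).eval (finGammaTwo L v γH)) w ∈ 𝒪[w.1.adicCompletion L] := by
    rw [hχ]; exact SetLike.coe_mem _
  -- its residue is `χ̄_g(ū) ≠ 0`
  have hred : red (((finCharpolyTwo L v γH).eval (finGammaTwo L v γH)) w) =
      (redMat (((γH.1.val : GL (Fin 2) (LocalRing L v)).val).map (Pi.evalRingHom (fun w' : PlacesOver L v => w'.1.adicCompletion L) w))).charpoly.eval
        (red (finGammaTwo L v γH w)) := by
    rw [hχ, Subring.coe_subtype, red_coe, ← hG₀, GLn.charpoly_redMat_map_eq G₀, ← hu₀, Subring.coe_subtype, red_coe, Polynomial.eval_map,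
      Polynomial.eval₂_at_apply]
  have hval : valuation (w.1.adicCompletion L) (((finCharpolyTwo L v γH).eval (finGammaTwo L v γH)) w) = 1 :=
    valuation_eq_one_of_red_ne_zero hχO (by rw [hred]; exact hne)
  exact (v_eq_one_iff_valuation_eq_one _).2 hval

end Bridge

end Literature.NumberTheory.Rogawski1990

end
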